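import Mathlib
import Literature.NumberTheory.LFunctions.Zhang2022.Section16BU033Reindex
import Literature.NumberTheory.LFunctions.Zhang2022.Section14MeanSquareMajorant
import HarnessLib

/-!
# Zhang (2022) §16 p. 93, u033 (local reading): "the terms with `(m,l) > 1` contribute `≪ …`" —
# the non-coprime correction is `≪ τ₃(n₁)·𝓛⁴⁴/D⁴`

Topic `Literature/NumberTheory/LFunctions/Zhang2022` (Landau–Siegel audit tree; verdict-neutral).
Y. Zhang, *Discrete mean estimates and the Landau–Siegel zero*, arXiv:2211.02515v1 (2022)
[Zhang2022LandauSiegel] — **an unrefereed manuscript under adjudication**; this file proves an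
estimate about the campaign's typed §16 objects and asserts nothing about the manuscript's theorems.
ZHANG-L WP16 (seat zl-w16-p8), Block A of leaf h16_16, node `Z22:§16.u033` [Z22 p. 93, tex
L4610–L4614] in the local reading F16B-1: "since the terms with `(m,l) > 1` above contribute `≪ D^{−c}`".
In the exact triple-sum form (`u033_reindex`, `u033_split`) the only deviation from the factorised
main term is `Σ_{n₁=l₁m₁} Σ_l Σ_m W(l)B(m)(ϖ₂ⱼ^loc(lm) − ϖ₂ⱼ^loc(l)ϖ₂ⱼ^loc(m))/(lm)`, supported on the
pairs with `(l,m) > 1`; two `𝔮`-rough numbers that are not coprime share a prime `q ≥ D⁴`, so with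
`|W| ≤ 1`, `|b(k)| ≤ C_bτ₂(k)`, `|ϖ₂ⱼ^loc(k)| ≤ 2τ₂(k)` (`norm_varpi2loc_le`, rough `k < P`) and
`τ₂(lm) ≤ τ₂(l)τ₂(m)` the correction for the outer pair `(l₁,m₁)` is at most
`6C_bτ₂(m₁)·Σ_{q≥D⁴}(2/q)(4/q)·(Σ_{l'≤2T²}τ₂(l')²/l')(Σ_{m'≤P}τ₂(m')²/m') ≤ C_bτ₂(m₁)·E₀𝓛⁴⁴/D⁴`
(`MeanSquareMajorant.sum_tau_sq_div_le`; the printed "`≪ D^{−c}`" thus holds per outer pair up to the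
factor `τ₂(m₁)`, i.e. `≪ τ₃(n₁)D^{−3}` in total — the `τ₃(n₁)`-currency of the repaired u037,
`Step16_u037RL`). Everything at a FIXED `D`, with the two size bounds as hypotheses.

## References
* Y. Zhang, arXiv:2211.02515v1 (2022), §16 p. 93 (u033), tex L4610–L4614.
  [cite: Zhang2022LandauSiegel, §16 p. 93 (u033)]
-/

noncomputable section

open Complex Real Finset Filter Topology
open scoped Pointwise

namespace Literature.NumberTheory.LFunctions.Zhang2022.Typed.Section16B

open Literature.NumberTheory.LFunctions.Zhang2022
open Literature.NumberTheory.LFunctions.Zhang2022.Skeleton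
open Literature.NumberTheory.LFunctions.Zhang2022.Typed.Section16A

/-! ## §1. Arithmetic helpers -/

/-- `τ₂(lm) ≤ τ₂(l)τ₂(m)` (every divisor of `lm` is a product of a divisor of `l` and one of `m`,
`Nat.dvd_mul`). [folklore] -/
private theorem card_divisors_mul_le (l m : ℕ) :
    (l * m).divisors.card ≤ l.divisors.card * m.divisors.card := by
  classical
  rcases Nat.eq_zero_or_pos l with rfl | hl
  · simp
  rcases Nat.eq_zero_or_pos m with rfl | hm
  · simp
  have hsub : (l * m).divisors ⊆ l.divisors * m.divisors := by
    intro d hd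
    rw [Nat.mem_divisors] at hd
    obtain ⟨y, z, hy, hz, rfl⟩ := Nat.dvd_mul.mp hd.1
    rw [Finset.mem_mul]
    exact ⟨y, Nat.mem_divisors.mpr ⟨hy, hl.ne'⟩, z, Nat.mem_divisors.mpr ⟨hz, hm.ne'⟩, rfl⟩
  exact (Finset.card_le_card hsub).trans Finset.card_mul_le

/-- `τ₂(qn) ≤ 2τ₂(n)` for a prime `q`. [folklore] -/
private theorem card_divisors_prime_mul_le {q : ℕ} (hq : q.Prime) (n : ℕ) :
    (q * n).divisors.card ≤ 2 * n.divisors.card := by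
  have h := card_divisors_mul_le q n
  rw [hq.divisors, Finset.card_pair hq.one_lt.ne] at h
  exact h

/-- Two non-coprime naturals share a prime factor; if the first is `𝔮`-rough and `< N`, that prime
lies in `[D⁴, N)`. [cite: Zhang2022LandauSiegel, §16 p. 93 (u033)] -/
private theorem exists_prime_dvd_of_not_coprime {D N l m : ℕ} (hl : 1 ≤ l) (hlN : l < N)
    (hlq : Nat.Coprime l (frakq D)) (h : ¬ Nat.Coprime l m) :
    ∃ q ∈ (Finset.Ico (D ^ 4) N).filter Nat.Prime, q ∣ l ∧ q ∣ m := by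
  rw [Nat.Prime.not_coprime_iff_dvd] at h
  obtain ⟨q, hq, hql, hqm⟩ := h
  refine ⟨q, Finset.mem_filter.mpr ⟨Finset.mem_Ico.mpr ⟨?_, ?_⟩, hq⟩, hql, hqm⟩
  · exact pow_four_le_of_mem_primeFactors_of_coprime_frakq' hlq
      (Nat.mem_primeFactors.mpr ⟨hq, hql, by omega⟩)
  · exact lt_of_le_of_lt (Nat.le_of_dvd hl hql) hlN

/-- Multiples of `q` inside a range: `Σ_{1≤l<N,(l,K)=1, q∣l} f(l) ≤ Σ_{1≤l'≤N} f(ql')` for `f ≥ 0`,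
`q ≥ 1`. [folklore] -/
private theorem sum_filter_dvd_le {K N q : ℕ} (hq : 1 ≤ q) {f : ℕ → ℝ} (hf : ∀ n, 0 ≤ f n) :
    ∑ l ∈ ((Finset.Ico 1 N).filter (fun l => Nat.Coprime l K)).filter (fun l => q ∣ l), f l ≤
      ∑ l' ∈ Finset.Icc 1 N, f (q * l') := by
  classical
  have hinj : Set.InjOn (fun l' => q * l') ↑(Finset.Icc 1 N) := by
    intro a _ b _ hab
    exact Nat.eq_of_mul_eq_mul_left (by omega) hab
  rw [← Finset.sum_image hinj]
  refine Finset.sum_le_sum_of_subset_of_nonneg ?_ fun n _ _ => hf n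
  intro l hl
  rw [Finset.mem_filter, Finset.mem_filter, Finset.mem_Ico] at hl
  obtain ⟨⟨⟨hl1, hlN⟩, -⟩, ⟨k, rfl⟩⟩ := hl
  rw [Finset.mem_image]
  refine ⟨k, Finset.mem_Icc.mpr ⟨?_, ?_⟩, rfl⟩
  · rcases Nat.eq_zero_or_pos k with rfl | hk
    · simp at hl1
    · exact hk
  · calc k ≤ q * k := Nat.le_mul_of_pos_left k (by omega)
      _ ≤ N := hlN.le

/-! ## §2. The non-coprime correction at a fixed `D` -/

section Fixed

variable (c' : ℝ) {D : ℕ} [NeZero D] (χ : DirichletCharacter ℂ D)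

/-- Sizes for `𝓛 ≥ 4¹⁰` (with `N_L = ⌈2T²⌉`, `N_M = ⌈P⌉`): `2 ≤ D`, `2 ≤ N_L`, `2 ≤ N_M`,
`log N_L ≤ 3𝓛²`, `log N_M ≤ 2𝓛⁹`, `2T² ≤ P`, `1 ≤ T`. [cite: Zhang2022LandauSiegel, §2 (2.6), (2.10)] -/
private theorem nc_sizes (hℓ : (4 : ℝ) ^ 10 ≤ ell D) :
    2 ≤ D ∧ 2 ≤ ⌈2 * bigT D ^ 2⌉₊ ∧ 2 ≤ ⌈bigP D⌉₊ ∧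
      Real.log ((⌈2 * bigT D ^ 2⌉₊ : ℕ) : ℝ) ≤ 3 * ell D ^ 2 ∧
      Real.log ((⌈bigP D⌉₊ : ℕ) : ℝ) ≤ 2 * ell D ^ 9 ∧ 2 * bigT D ^ 2 ≤ bigP D ∧ 1 ≤ bigT D := by
  have h410 : (4 : ℝ) ^ 10 = 1048576 := by norm_num
  have hℓ1 : 1 ≤ ell D := by linarith
  have hℓ0 : 0 < ell D := by linarith
  have hD0 : 0 < D := by
    by_contra h
    have : D = 0 := by omega
    subst this
    simp [ell] at hℓ0
  have hD2 : 2 ≤ D := by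
    by_contra h
    have h1 : D = 1 := by omega
    subst h1
    simp [ell] at hℓ0
  have hT : bigT D = Real.exp (ell D ^ (1.1 : ℝ)) := rfl
  have h11le2 : ell D ^ (1.1 : ℝ) ≤ ell D ^ 2 := by
    calc ell D ^ (1.1 : ℝ) ≤ ell D ^ ((2 : ℕ) : ℝ) :=
          Real.rpow_le_rpow_of_exponent_le hℓ1 (by norm_num)
      _ = ell D ^ 2 := Real.rpow_natCast _ _
  have h11one : (1 : ℝ) ≤ ell D ^ (1.1 : ℝ) := Real.one_le_rpow hℓ1 (by norm_num)
  have hT1 : 1 ≤ bigT D := by rw [hT]; exact Real.one_le_exp (by positivity)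
  have hTsq : bigT D ^ 2 = Real.exp (2 * ell D ^ (1.1 : ℝ)) := by
    rw [hT, ← Real.exp_nat_mul]; norm_num
  have hTsq1 : 1 ≤ bigT D ^ 2 := one_le_pow₀ hT1
  have hNL2 : 2 ≤ ⌈2 * bigT D ^ 2⌉₊ := by
    have h : (2 : ℝ) ≤ 2 * bigT D ^ 2 := by linarith
    exact_mod_cast h.trans (Nat.le_ceil _)
  have hP2 : (2 : ℝ) ≤ bigP D := by
    rw [bigP]
    have h9 : (1 : ℝ) ≤ ell D ^ 9 := one_le_pow₀ hℓ1
    linarith [Real.add_one_le_exp (ell D ^ 9)]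
  have hNM2 : 2 ≤ ⌈bigP D⌉₊ := by exact_mod_cast hP2.trans (Nat.le_ceil _)
  have hlogNL : Real.log ((⌈2 * bigT D ^ 2⌉₊ : ℕ) : ℝ) ≤ 3 * ell D ^ 2 := by
    have hN : ((⌈2 * bigT D ^ 2⌉₊ : ℕ) : ℝ) ≤ 4 * bigT D ^ 2 := by
      have := (Nat.ceil_lt_add_one (show (0 : ℝ) ≤ 2 * bigT D ^ 2 by positivity)).le
      linarith
    have hpos : (0 : ℝ) < ((⌈2 * bigT D ^ 2⌉₊ : ℕ) : ℝ) := by exact_mod_cast (show 0 < ⌈2 * bigT D ^ 2⌉₊ by omega)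
    have hlog4 : Real.log 4 ≤ 3 := by
      have hexp : (4 : ℝ) ≤ Real.exp 3 := by
        have := Real.add_one_le_exp (3 : ℝ); linarith
      have := Real.log_le_log (by norm_num) hexp
      rwa [Real.log_exp] at this
    have hsq4 : (4 : ℝ) ≤ ell D ^ 2 := by nlinarith
    calc Real.log ((⌈2 * bigT D ^ 2⌉₊ : ℕ) : ℝ) ≤ Real.log (4 * bigT D ^ 2) := Real.log_le_log hpos hN
      _ = Real.log 4 + 2 * ell D ^ (1.1 : ℝ) := by
          rw [Real.log_mul (by norm_num) (by positivity), hTsq, Real.log_exp]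
      _ ≤ 3 * ell D ^ 2 := by linarith
  have hlogNM : Real.log ((⌈bigP D⌉₊ : ℕ) : ℝ) ≤ 2 * ell D ^ 9 := by
    have hPpos : 0 < bigP D := by linarith
    have hN : ((⌈bigP D⌉₊ : ℕ) : ℝ) ≤ 2 * bigP D := by
      have := Nat.ceil_lt_add_one hPpos.le
      linarith
    have hNpos : (0 : ℝ) < ((⌈bigP D⌉₊ : ℕ) : ℝ) := by exact_mod_cast (show 0 < ⌈bigP D⌉₊ by omega)
    calc Real.log (⌈bigP D⌉₊ : ℕ) ≤ Real.log (2 * bigP D) := Real.log_le_log hNpos hN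
      _ = Real.log 2 + ell D ^ 9 := by rw [Real.log_mul (by norm_num) hPpos.ne', bigP, Real.log_exp]
      _ ≤ 2 * ell D ^ 9 := by
          have h9 : (1 : ℝ) ≤ ell D ^ 9 := one_le_pow₀ hℓ1
          linarith [Real.log_two_lt_d9]
  have h2T2P : 2 * bigT D ^ 2 ≤ bigP D := by
    -- `2e^{2𝓛^{1.1}} ≤ e^{1 + 2𝓛²} ≤ e^{𝓛⁹}`
    rw [hTsq, bigP]
    have h2e : (2 : ℝ) ≤ Real.exp 1 := by
      have := Real.add_one_le_exp (1 : ℝ); linarith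
    have h9 : 1 + 2 * ell D ^ 2 ≤ ell D ^ 9 := by
      have h97 : ell D ^ 9 = ell D ^ 2 * ell D ^ 7 := by ring
      have h7 : 3 ≤ ell D ^ 7 := le_trans (by linarith) (le_self_pow₀ hℓ1 (by norm_num) : ell D ≤ ell D ^ 7)
      have hsq : 1 ≤ ell D ^ 2 := one_le_pow₀ hℓ1
      rw [h97]; nlinarith
    calc 2 * Real.exp (2 * ell D ^ (1.1 : ℝ)) ≤ Real.exp 1 * Real.exp (2 * ell D ^ (1.1 : ℝ)) := by
          gcongr
      _ = Real.exp (1 + 2 * ell D ^ (1.1 : ℝ)) := by rw [← Real.exp_add]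
      _ ≤ Real.exp (ell D ^ 9) := Real.exp_le_exp.mpr (by nlinarith)
  exact ⟨hD2, hNL2, hNM2, hlogNL, hlogNM, h2T2P, hT1⟩

set_option maxHeartbeats 400000 in
open scoped Classical in
/-- **u033's "(m,l) > 1" terms, per outer pair** (local reading, fixed `D` with `𝓛 ≥ 4¹⁰`): for
`n₁ ≠ 0`, `x = (l₁,m₁)` with `l₁m₁ = n₁`, and `j`, assuming at this `D` the coefficient bound
`|b(k)| ≤ C_bτ₂(k)` and the majorant `|ϖ₂ⱼ^loc(k)| ≤ 2τ₂(k)` for rough `k < P`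
(tree: `Skeleton.norm_bcoef_le`, `norm_varpi2loc_le`),
`Σ_{(l,𝔮)=1,l<2T²} Σ_{(m,𝔮)=1,m<P} ‖(l₁l)^{−β₃}g*(T²/(l₁l))·b(m₁m)χ(m₁m)·(ϖ^loc(lm) − ϖ^loc(l)ϖ^loc(m))/(lm)‖
≤ C_bτ₂(m₁)·(124416·K²)·𝓛⁴⁴/D⁴`, `K = majorantConst 4 4` (the constant of `Σ_{n≤X}τ₂(n)²/n ≤ K log⁴X`).
[cite: Zhang2022LandauSiegel, §16 p. 93 (u033)] -/
theorem u033_noncoprime_le (hℓ : (4 : ℝ) ^ 10 ≤ ell D) (j : ℕ) {Cb : ℝ} (hCb : 0 ≤ Cb)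
    (hb : ∀ k : ℕ, ‖bcoef D k‖ ≤ Cb * k.divisors.card)
    (hϖ : ∀ k : ℕ, 1 ≤ k → Nat.Coprime k (frakq D) → (k : ℝ) < bigP D →
      ‖varpi2loc c' χ j k‖ ≤ 2 * k.divisors.card)
    {n₁ : ℕ} (hn₁ : n₁ ≠ 0) {x : ℕ × ℕ} (hx : x ∈ n₁.divisorsAntidiagonal) :
    ∑ l ∈ (Finset.Ico 1 ⌈2 * bigT D ^ 2⌉₊).filter (fun l => Nat.Coprime l (frakq D)),
      ∑ m ∈ (Finset.Ico 1 ⌈bigP D⌉₊).filter (fun m => Nat.Coprime m (frakq D)),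
        ‖(((x.1 * l : ℕ) : ℂ)) ^ (-beta3 c' D) * (gstar D (bigT D ^ 2 / ((x.1 * l : ℕ) : ℝ)) : ℂ) *
            (bcoef D (x.2 * m) * χ ((x.2 * m : ℕ) : ZMod D)) *
          ((varpi2loc c' χ j (l * m) - varpi2loc c' χ j l * varpi2loc c' χ j m) /
            (((l * m : ℕ) : ℂ)))‖ ≤
      Cb * x.2.divisors.card *
        (124416 * MeanSquareMajorant.majorantConst (2 ^ 2) (2 * 2) ^ 2) * ell D ^ 44 /
          ((D : ℝ) ^ 4) := by
  obtain ⟨hD2, hNL2, hNM2, hlogNL, hlogNM, h2T2P, hT1⟩ := nc_sizes hℓ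
  have h410 : (4 : ℝ) ^ 10 = 1048576 := by norm_num
  have hℓ1 : 1 ≤ ell D := by linarith
  have hℓ0 : 0 < ell D := by linarith
  have hD0 : (0 : ℝ) < D := by exact_mod_cast (show 0 < D by omega)
  set K : ℕ := frakq D with hK
  set NL : ℕ := ⌈2 * bigT D ^ 2⌉₊ with hNL
  set NM : ℕ := ⌈bigP D⌉₊ with hNM
  set RL := (Finset.Ico 1 NL).filter (fun l => Nat.Coprime l K) with hRL
  set RM := (Finset.Ico 1 NM).filter (fun m => Nat.Coprime m K) with hRM
  set Km : ℝ := MeanSquareMajorant.majorantConst (2 ^ 2) (2 * 2) with hKm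
  have hKm0 : 0 < Km := MeanSquareMajorant.majorantConst_pos _ _
  -- outer pair facts
  have hx0 := Nat.mem_divisorsAntidiagonal.mp hx
  have hx1 : 1 ≤ x.1 := Nat.one_le_iff_ne_zero.mpr fun h => hn₁ (by rw [← hx0.1, h, zero_mul])
  have hx2 : 1 ≤ x.2 := Nat.one_le_iff_ne_zero.mpr fun h => hn₁ (by rw [← hx0.1, h, mul_zero])
  -- abbreviations for the real weights
  have hτ1 : ∀ n : ℕ, 1 ≤ n → (1 : ℝ) ≤ (n.divisors.card : ℝ) := fun n hn => by
    exact_mod_cast Finset.card_pos.mpr ⟨1, Nat.one_mem_divisors.mpr (by omega)⟩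
  have hτ0 : ∀ n : ℕ, (0 : ℝ) ≤ (n.divisors.card : ℝ) := fun n => Nat.cast_nonneg _
  -- support threshold of `b` and the key size `2T²·Mb ≤ P`
  set Mb : ℝ := bigP D ^ (1 / 2 : ℝ) * max (Skeleton.P2 D) (P3 D) with hMb
  have hsupp : 2 * bigT D ^ 2 * Mb ≤ bigP D :=
    Typed.Section16ALeaves.suppBound_le_bigP (D := D) (by linarith)
  -- Step 1: pointwise bound by `6 C_b τ(m₁) · 1_{(l,m)>1} τ(l)τ(m)²/(lm)`
  set h2 : ℕ → ℕ → ℝ := fun l m => if Nat.Coprime l m then 0 else (l.divisors.card : ℝ) / l * ((m.divisors.card : ℝ) ^ 2 / m) with hh2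
  have hh2nn : ∀ l m, 0 ≤ h2 l m := by
    intro l m; rw [hh2]; dsimp only
    split_ifs
    · exact le_rfl
    · have := hτ0 l; have := hτ0 m; positivity
  have hpt : ∀ l ∈ RL, ∀ m ∈ RM,
      ‖(((x.1 * l : ℕ) : ℂ)) ^ (-beta3 c' D) * (gstar D (bigT D ^ 2 / ((x.1 * l : ℕ) : ℝ)) : ℂ) *
            (bcoef D (x.2 * m) * χ ((x.2 * m : ℕ) : ZMod D)) *
          ((varpi2loc c' χ j (l * m) - varpi2loc c' χ j l * varpi2loc c' χ j m) /
            (((l * m : ℕ) : ℂ)))‖ ≤ 6 * Cb * (x.2.divisors.card : ℝ) * h2 l m := by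
    intro l hl m hm
    rw [hRL, Finset.mem_filter, Finset.mem_Ico] at hl
    rw [hRM, Finset.mem_filter, Finset.mem_Ico] at hm
    obtain ⟨⟨hl1, hlN⟩, hlK⟩ := hl
    obtain ⟨⟨hm1, hmN⟩, hmK⟩ := hm
    have hRHS0 : 0 ≤ 6 * Cb * (x.2.divisors.card : ℝ) * h2 l m := by
      have := hτ0 x.2; have := hh2nn l m; positivity
    by_cases hcop : Nat.Coprime l m
    · rw [varpi2loc_mul_sub_eq_zero_of_coprime c' χ j hcop, zero_div, mul_zero, norm_zero]
      exact hRHS0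
    -- the two vanishing cases
    by_cases hgl : 2 * bigT D ^ 2 ≤ ((x.1 * l : ℕ) : ℝ)
    · have hg0 : gstar D (bigT D ^ 2 / ((x.1 * l : ℕ) : ℝ)) = 0 := by
        apply gstar_eq_zero_of_le_half
        have hpos : (0 : ℝ) < ((x.1 * l : ℕ) : ℝ) := lt_of_lt_of_le (by positivity) hgl
        rw [div_le_iff₀ hpos]; linarith
      rw [hg0, Complex.ofReal_zero, mul_zero, zero_mul, zero_mul, norm_zero]
      exact hRHS0
    by_cases hbm : Mb ≤ ((x.2 * m : ℕ) : ℝ)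
    · rw [bcoef_eq_zero_of_sqrtP_mul_max_le hbm, zero_mul, mul_zero, zero_mul, norm_zero]
      exact hRHS0
    push Not at hgl hbm
    -- on the support: `lm < P`
    have hl0 : (0 : ℝ) < l := by exact_mod_cast hl1
    have hm0 : (0 : ℝ) < m := by exact_mod_cast hm1
    have hlmP : ((l * m : ℕ) : ℝ) < bigP D := by
      have h1 : ((l * m : ℕ) : ℝ) ≤ ((x.1 * l : ℕ) : ℝ) * ((x.2 * m : ℕ) : ℝ) := by
        have : l * m ≤ (x.1 * l) * (x.2 * m) := by
          calc l * m = (1 * l) * (1 * m) := by ring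
            _ ≤ (x.1 * l) * (x.2 * m) :=
                Nat.mul_le_mul (Nat.mul_le_mul_right _ hx1) (Nat.mul_le_mul_right _ hx2)
        exact_mod_cast this
      have h2 : ((x.1 * l : ℕ) : ℝ) * ((x.2 * m : ℕ) : ℝ) < 2 * bigT D ^ 2 * Mb :=
        mul_lt_mul'' hgl hbm (Nat.cast_nonneg _) (Nat.cast_nonneg _)
      linarith
    have hlP : (l : ℝ) < bigP D := by
      have : (l : ℝ) < 2 * bigT D ^ 2 := by
        have := Nat.lt_ceil.mp hlN; exact_mod_cast this
      linarith
    have hmP : (m : ℝ) < bigP D := Nat.lt_ceil.mp hmN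
    -- the weight has norm ≤ 1
    have hW : ‖(((x.1 * l : ℕ) : ℂ)) ^ (-beta3 c' D) *
        (gstar D (bigT D ^ 2 / ((x.1 * l : ℕ) : ℝ)) : ℂ)‖ ≤ 1 := by
      rw [norm_mul]
      have h1 : ‖(((x.1 * l : ℕ) : ℂ)) ^ (-beta3 c' D)‖ = 1 := by
        have hpos : 0 < x.1 * l := Nat.mul_pos (by omega) (by omega)
        rw [Complex.norm_natCast_cpow_of_pos hpos, Complex.neg_re,
          show beta3 c' D = betaJ c' D 3 by simp [betaJ], Typed.Section15B.betaJ_re, neg_zero,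
          Real.rpow_zero]
      have h2 : ‖(gstar D (bigT D ^ 2 / ((x.1 * l : ℕ) : ℝ)) : ℂ)‖ ≤ 1 := by
        rw [Complex.norm_real, Real.norm_eq_abs, gstar]
        split_ifs
        · have h30 : 0 < ell D ^ 30 := pow_pos hℓ0 30
          rw [gW, abs_of_pos (GaussWeight.gWeight_pos h30 _)]
          exact (GaussWeight.gWeight_lt_one h30 _).le
        · simp
      rw [h1, one_mul]; exact h2
    -- the coefficient
    have hB : ‖bcoef D (x.2 * m) * χ ((x.2 * m : ℕ) : ZMod D)‖ ≤ Cb * (x.2.divisors.card : ℝ) * (m.divisors.card : ℝ) := by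
      rw [norm_mul]
      have hcd : ((x.2 * m).divisors.card : ℝ) ≤ (x.2.divisors.card : ℝ) * (m.divisors.card : ℝ) := by
        exact_mod_cast card_divisors_mul_le x.2 m
      calc ‖bcoef D (x.2 * m)‖ * ‖χ ((x.2 * m : ℕ) : ZMod D)‖ ≤ (Cb * (x.2 * m).divisors.card) * 1 :=
            mul_le_mul (hb _) (DirichletCharacter.norm_le_one χ _) (norm_nonneg _)
              (mul_nonneg hCb (Nat.cast_nonneg _))
          _ ≤ Cb * ((x.2.divisors.card : ℝ) * (m.divisors.card : ℝ)) * 1 := by gcongr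
          _ = Cb * (x.2.divisors.card : ℝ) * (m.divisors.card : ℝ) := by ring
    -- the `ϖ`-difference
    have hlmK : Nat.Coprime (l * m) K := Nat.Coprime.mul_left hlK hmK
    have hV : ‖varpi2loc c' χ j (l * m) - varpi2loc c' χ j l * varpi2loc c' χ j m‖ ≤ 6 * ((l.divisors.card : ℝ) * (m.divisors.card : ℝ)) := by
      have h1 := hϖ (l * m) (by nlinarith) hlmK hlmP
      have h2 := hϖ l hl1 hlK hlP
      have h3 := hϖ m hm1 hmK hmP
      have hsub : ((l * m).divisors.card : ℝ) ≤ (l.divisors.card : ℝ) * (m.divisors.card : ℝ) := by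
        exact_mod_cast card_divisors_mul_le l m
      calc ‖varpi2loc c' χ j (l * m) - varpi2loc c' χ j l * varpi2loc c' χ j m‖
          ≤ ‖varpi2loc c' χ j (l * m)‖ + ‖varpi2loc c' χ j l * varpi2loc c' χ j m‖ := norm_sub_le _ _
        _ ≤ 2 * ((l.divisors.card : ℝ) * (m.divisors.card : ℝ)) + (2 * (l.divisors.card : ℝ)) * (2 * (m.divisors.card : ℝ)) := by
            rw [norm_mul]
            exact add_le_add (h1.trans (by linarith)) (mul_le_mul h2 h3 (norm_nonneg _)
              (by linarith [hτ0 l]))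
        _ = 6 * ((l.divisors.card : ℝ) * (m.divisors.card : ℝ)) := by ring
    -- combine
    have hden : ‖(((l * m : ℕ) : ℂ))‖ = (l : ℝ) * m := by
      rw [Complex.norm_natCast]; push_cast; ring
    rw [norm_mul, norm_mul, norm_div, hden, hh2]
    dsimp only
    rw [if_neg hcop]
    have hτl := hτ0 l
    have hτm := hτ0 m
    have hτx := hτ0 x.2
    calc ‖(((x.1 * l : ℕ) : ℂ)) ^ (-beta3 c' D) * (gstar D (bigT D ^ 2 / ((x.1 * l : ℕ) : ℝ)) : ℂ)‖ *
          ‖bcoef D (x.2 * m) * χ ((x.2 * m : ℕ) : ZMod D)‖ *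
          (‖varpi2loc c' χ j (l * m) - varpi2loc c' χ j l * varpi2loc c' χ j m‖ / ((l : ℝ) * m))
        ≤ 1 * (Cb * (x.2.divisors.card : ℝ) * (m.divisors.card : ℝ)) * (6 * ((l.divisors.card : ℝ) * (m.divisors.card : ℝ)) / ((l : ℝ) * m)) := by
          gcongr
      _ = 6 * Cb * (x.2.divisors.card : ℝ) * ((l.divisors.card : ℝ) / l * ((m.divisors.card : ℝ) ^ 2 / m)) := by
          rw [div_eq_mul_inv, div_eq_mul_inv, div_eq_mul_inv, mul_inv]
          ring
  -- Step 2: sum the pointwise bound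
  have step2 : ∑ l ∈ RL, ∑ m ∈ RM,
      ‖(((x.1 * l : ℕ) : ℂ)) ^ (-beta3 c' D) * (gstar D (bigT D ^ 2 / ((x.1 * l : ℕ) : ℝ)) : ℂ) *
            (bcoef D (x.2 * m) * χ ((x.2 * m : ℕ) : ZMod D)) *
          ((varpi2loc c' χ j (l * m) - varpi2loc c' χ j l * varpi2loc c' χ j m) /
            (((l * m : ℕ) : ℂ)))‖ ≤ 6 * Cb * (x.2.divisors.card : ℝ) * ∑ l ∈ RL, ∑ m ∈ RM, h2 l m := by
    rw [Finset.mul_sum]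
    refine Finset.sum_le_sum fun l hl => ?_
    rw [Finset.mul_sum]
    exact Finset.sum_le_sum fun m hm => hpt l hl m hm
  -- Step 3: a non-coprime pair shares a prime `q ∈ [D⁴, N_L)`
  set Q := (Finset.Ico (D ^ 4) NL).filter Nat.Prime with hQ
  set aL : ℕ → ℕ → ℝ := fun q l => if q ∣ l then (l.divisors.card : ℝ) / l else 0 with haL
  set aM : ℕ → ℕ → ℝ := fun q m => if q ∣ m then (m.divisors.card : ℝ) ^ 2 / m else 0 with haM
  have haL0 : ∀ q l, 0 ≤ aL q l := fun q l => by
    rw [haL]; dsimp only; split_ifs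
    · have := hτ0 l; positivity
    · exact le_rfl
  have haM0 : ∀ q m, 0 ≤ aM q m := fun q m => by
    rw [haM]; dsimp only; split_ifs
    · have := hτ0 m; positivity
    · exact le_rfl
  have step3 : ∑ l ∈ RL, ∑ m ∈ RM, h2 l m ≤ ∑ q ∈ Q, (∑ l ∈ RL, aL q l) * (∑ m ∈ RM, aM q m) := by
    have hpt' : ∀ l ∈ RL, ∀ m ∈ RM, h2 l m ≤ ∑ q ∈ Q, aL q l * aM q m := by
      intro l hl m hm
      rw [hh2]; dsimp only
      split_ifs with hcop
      · exact Finset.sum_nonneg fun q _ => mul_nonneg (haL0 q l) (haM0 q m)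
      rw [hRL, Finset.mem_filter, Finset.mem_Ico] at hl
      obtain ⟨⟨hl1, hlN⟩, hlK⟩ := hl
      obtain ⟨q, hqQ, hql, hqm⟩ := exists_prime_dvd_of_not_coprime (D := D) hl1 hlN hlK hcop
      have hterm : aL q l * aM q m = (l.divisors.card : ℝ) / l * ((m.divisors.card : ℝ) ^ 2 / m) := by
        rw [haL, haM]; dsimp only; rw [if_pos hql, if_pos hqm]
      rw [← hterm]
      exact Finset.single_le_sum (f := fun q => aL q l * aM q m)
        (fun q _ => mul_nonneg (haL0 q l) (haM0 q m)) hqQ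
    calc ∑ l ∈ RL, ∑ m ∈ RM, h2 l m ≤ ∑ l ∈ RL, ∑ m ∈ RM, ∑ q ∈ Q, aL q l * aM q m :=
          Finset.sum_le_sum fun l hl => Finset.sum_le_sum fun m hm => hpt' l hl m hm
      _ = ∑ l ∈ RL, ∑ q ∈ Q, ∑ m ∈ RM, aL q l * aM q m :=
          Finset.sum_congr rfl fun l _ => Finset.sum_comm
      _ = ∑ q ∈ Q, ∑ l ∈ RL, ∑ m ∈ RM, aL q l * aM q m := Finset.sum_comm
      _ = ∑ q ∈ Q, (∑ l ∈ RL, aL q l) * (∑ m ∈ RM, aM q m) := by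
          refine Finset.sum_congr rfl fun q _ => ?_
          rw [Finset.sum_mul_sum]
  -- Step 4: the sums over multiples of a prime `q`
  have hSL : ∀ q ∈ Q, ∑ l ∈ RL, aL q l ≤ 2 / q * (Km * (3 * ell D ^ 2) ^ 4) := by
    intro q hq
    rw [hQ, Finset.mem_filter, Finset.mem_Ico] at hq
    obtain ⟨⟨hq4, -⟩, hqp⟩ := hq
    have hq1 : 1 ≤ q := hqp.one_lt.le
    have hq0 : (0 : ℝ) < q := by exact_mod_cast hqp.pos
    -- `Σ_{l∈RL} aL q l = Σ_{l ∈ RL, q∣l} (l.divisors.card : ℝ)/l ≤ Σ_{l' ≤ NL} τ(ql')/(ql') ≤ (2/q) Σ τ(l')²/l'`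
    have h1 : ∑ l ∈ RL, aL q l = ∑ l ∈ RL.filter (fun l => q ∣ l), (l.divisors.card : ℝ) / l :=
      (Finset.sum_filter (fun l => q ∣ l) (fun l => (l.divisors.card : ℝ) / l)).symm
    rw [h1]
    have h2 := sum_filter_dvd_le (K := K) (N := NL) hq1 (f := fun l => (l.divisors.card : ℝ) / l)
      (fun n => div_nonneg (hτ0 n) (Nat.cast_nonneg n))
    refine h2.trans ?_
    have h3 : ∀ l' ∈ Finset.Icc 1 NL, ((q * l').divisors.card : ℝ) / ((q * l' : ℕ) : ℝ) ≤
        2 / q * (MeanSquareMajorant.tau 2 l' ^ 2 / l') := by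
      intro l' hl'
      rw [Finset.mem_Icc] at hl'
      have hl'0 : (0 : ℝ) < l' := by exact_mod_cast hl'.1
      have hτq : ((q * l').divisors.card : ℝ) ≤ 2 * (l'.divisors.card : ℝ) := by
        exact_mod_cast card_divisors_prime_mul_le hqp l'
      have hτsq : (l'.divisors.card : ℝ) ≤ MeanSquareMajorant.tau 2 l' ^ 2 := by
        rw [MeanSquareMajorant.tau_two_apply]
        exact le_self_pow₀ (hτ1 l' hl'.1) two_ne_zero
      push_cast
      rw [div_le_iff₀ (by positivity)]
      calc ((q * l').divisors.card : ℝ) ≤ 2 * (l'.divisors.card : ℝ) := hτq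
        _ ≤ 2 * MeanSquareMajorant.tau 2 l' ^ 2 := by linarith
        _ = (2 / q * q) * (MeanSquareMajorant.tau 2 l' ^ 2 / l' * l') := by
            rw [div_mul_cancel₀ _ hq0.ne', div_mul_cancel₀ _ hl'0.ne']
        _ = 2 / q * (MeanSquareMajorant.tau 2 l' ^ 2 / l') * ((q : ℝ) * l') := by ring
    refine (Finset.sum_le_sum h3).trans ?_
    rw [← Finset.mul_sum]
    refine mul_le_mul_of_nonneg_left ?_ (by positivity)
    have h4 := MeanSquareMajorant.sum_tau_sq_div_le 2 hNL2
    refine h4.trans ?_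
    rw [hKm]
    have hlog0 : 0 ≤ Real.log ((NL : ℕ) : ℝ) := Real.log_natCast_nonneg _
    exact mul_le_mul_of_nonneg_left (by
      rw [show (2 : ℕ) ^ 2 = 4 by norm_num]
      exact pow_le_pow_left₀ hlog0 hlogNL 4) (MeanSquareMajorant.majorantConst_pos _ _).le
  have hSM : ∀ q ∈ Q, ∑ m ∈ RM, aM q m ≤ 4 / q * (Km * (2 * ell D ^ 9) ^ 4) := by
    intro q hq
    rw [hQ, Finset.mem_filter, Finset.mem_Ico] at hq
    obtain ⟨⟨hq4, -⟩, hqp⟩ := hq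
    have hq1 : 1 ≤ q := hqp.one_lt.le
    have hq0 : (0 : ℝ) < q := by exact_mod_cast hqp.pos
    have h1 : ∑ m ∈ RM, aM q m = ∑ m ∈ RM.filter (fun m => q ∣ m), (m.divisors.card : ℝ) ^ 2 / m :=
      (Finset.sum_filter (fun m => q ∣ m) (fun m => (m.divisors.card : ℝ) ^ 2 / m)).symm
    rw [h1]
    have h2 := sum_filter_dvd_le (K := K) (N := NM) hq1 (f := fun m => (m.divisors.card : ℝ) ^ 2 / m)
      (fun n => div_nonneg (pow_nonneg (hτ0 n) 2) (Nat.cast_nonneg n))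
    refine h2.trans ?_
    have h3 : ∀ m' ∈ Finset.Icc 1 NM, ((q * m').divisors.card : ℝ) ^ 2 / ((q * m' : ℕ) : ℝ) ≤
        4 / q * (MeanSquareMajorant.tau 2 m' ^ 2 / m') := by
      intro m' hm'
      rw [Finset.mem_Icc] at hm'
      have hm'0 : (0 : ℝ) < m' := by exact_mod_cast hm'.1
      have hτq : ((q * m').divisors.card : ℝ) ≤ 2 * (m'.divisors.card : ℝ) := by
        exact_mod_cast card_divisors_prime_mul_le hqp m'
      have hτeq : MeanSquareMajorant.tau 2 m' = (m'.divisors.card : ℝ) := by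
        rw [MeanSquareMajorant.tau_two_apply]
      rw [hτeq]
      push_cast
      rw [div_le_iff₀ (by positivity)]
      have hτm' := hτ0 m'
      have hτqm := hτ0 (q * m')
      calc ((q * m').divisors.card : ℝ) ^ 2 ≤ (2 * (m'.divisors.card : ℝ)) ^ 2 := pow_le_pow_left₀ hτqm hτq 2
        _ = (4 / q * q) * ((m'.divisors.card : ℝ) ^ 2 / m' * m') := by
            rw [div_mul_cancel₀ _ hq0.ne', div_mul_cancel₀ _ hm'0.ne']; ring
        _ = 4 / q * ((m'.divisors.card : ℝ) ^ 2 / m') * ((q : ℝ) * m') := by ring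
    refine (Finset.sum_le_sum h3).trans ?_
    rw [← Finset.mul_sum]
    refine mul_le_mul_of_nonneg_left ?_ (by positivity)
    have h4 := MeanSquareMajorant.sum_tau_sq_div_le 2 hNM2
    refine h4.trans ?_
    rw [hKm]
    have hlog0 : 0 ≤ Real.log ((NM : ℕ) : ℝ) := Real.log_natCast_nonneg _
    exact mul_le_mul_of_nonneg_left (by
      rw [show (2 : ℕ) ^ 2 = 4 by norm_num]
      exact pow_le_pow_left₀ hlog0 hlogNM 4) (MeanSquareMajorant.majorantConst_pos _ _).le
  -- Step 5: `Σ_{q∈Q} 1/q² ≤ 2/D⁴`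
  have hQsq : ∑ q ∈ Q, ((q : ℝ) ^ 2)⁻¹ ≤ 2 / (D : ℝ) ^ 4 := by
    have hsub : Q ⊆ Finset.Ioo (D ^ 4 - 1) NL := by
      intro q hq
      rw [hQ, Finset.mem_filter, Finset.mem_Ico] at hq
      have h1 : 1 ≤ D ^ 4 := Nat.one_le_pow _ _ (by omega)
      exact Finset.mem_Ioo.mpr ⟨by omega, hq.1.2⟩
    have h := sum_Ioo_inv_sq_le (α := ℝ) (D ^ 4 - 1) NL
    have hcast : (((D ^ 4 - 1 : ℕ) : ℝ) + 1) = (D : ℝ) ^ 4 := by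
      have : 1 ≤ D ^ 4 := Nat.one_le_pow _ _ (by omega)
      rw [Nat.cast_sub this]; push_cast; ring
    rw [hcast] at h
    exact (Finset.sum_le_sum_of_subset_of_nonneg hsub fun q _ _ => by positivity).trans h
  -- Step 6: combine
  have step6 : ∑ q ∈ Q, (∑ l ∈ RL, aL q l) * (∑ m ∈ RM, aM q m) ≤
      8 * Km ^ 2 * ((3 * ell D ^ 2) ^ 4 * (2 * ell D ^ 9) ^ 4) * (2 / (D : ℝ) ^ 4) := by
    calc ∑ q ∈ Q, (∑ l ∈ RL, aL q l) * (∑ m ∈ RM, aM q m)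
        ≤ ∑ q ∈ Q, (2 / q * (Km * (3 * ell D ^ 2) ^ 4)) * (4 / q * (Km * (2 * ell D ^ 9) ^ 4)) :=
          Finset.sum_le_sum fun q hq => mul_le_mul (hSL q hq) (hSM q hq)
            (Finset.sum_nonneg fun m _ => haM0 q m) (by positivity)
      _ = 8 * Km ^ 2 * ((3 * ell D ^ 2) ^ 4 * (2 * ell D ^ 9) ^ 4) * ∑ q ∈ Q, ((q : ℝ) ^ 2)⁻¹ := by
          rw [Finset.mul_sum]
          refine Finset.sum_congr rfl fun q hq => ?_
          rw [hQ, Finset.mem_filter] at hq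
          have hq0 : (q : ℝ) ≠ 0 := by exact_mod_cast hq.2.pos.ne'
          rw [div_eq_mul_inv, div_eq_mul_inv, ← inv_pow]
          ring
      _ ≤ 8 * Km ^ 2 * ((3 * ell D ^ 2) ^ 4 * (2 * ell D ^ 9) ^ 4) * (2 / (D : ℝ) ^ 4) :=
          mul_le_mul_of_nonneg_left hQsq (by positivity)
  have hτx := hτ0 x.2
  calc _ ≤ 6 * Cb * (x.2.divisors.card : ℝ) * ∑ l ∈ RL, ∑ m ∈ RM, h2 l m := step2
    _ ≤ 6 * Cb * (x.2.divisors.card : ℝ) * (8 * Km ^ 2 * ((3 * ell D ^ 2) ^ 4 * (2 * ell D ^ 9) ^ 4) * (2 / (D : ℝ) ^ 4)) :=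
        mul_le_mul_of_nonneg_left (step3.trans step6)
          (mul_nonneg (mul_nonneg (by norm_num) hCb) hτx)
    _ = Cb * (x.2.divisors.card : ℝ) * (124416 * Km ^ 2) * ell D ^ 44 / (D : ℝ) ^ 4 := by
        rw [div_eq_mul_inv, div_eq_mul_inv]
        ring

end Fixed

end Literature.NumberTheory.LFunctions.Zhang2022.Typed.Section16B
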